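import Literature.Probability.Process.PathSpaceBorel
import Mathlib.MeasureTheory.Measure.CharacteristicFunction.Basic
import Mathlib.Analysis.Normed.Lp.MeasurableSpace
import HarnessLib

/-!
# The law of a continuous complex process from the characteristic functions of its increments

Topic `Probability/Process`; theorems only. For complex-valued processes `Z¹`, `Z²` (on possibly
different probability spaces) with measurable marginals, both started at the same point `y₀`,
suppose the joint characteristic functions of the increments over every monotone grid
`0 = u₀ ≤ u₁ ≤ ⋯` agree:
`E[exp(i Σ_{j<n} Re(θ̄ⱼ(Z_{u_{j+1}} − Z_{u_j})))]` is the same for `Z¹` and `Z²`. Then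

* `measure_ext_of_integral_cexp_re_conj` — (uniqueness on `ℂⁿ`) two finite measures on
  `Fin n → ℂ` with the same `∫ exp(i Σⱼ Re(θ̄ⱼ xⱼ))` agree (Mathlib `Measure.ext_of_charFun` on the
  Hilbert space `PiLp 2`, the real inner product of `ℂ` being `Re(w̄ z)`);
* `map_fdd_eq_of_incr` — **the finite-dimensional distributions agree** (the values at the sorted
  times of a finite set are `y₀` plus partial sums of increments);
* `map_path_eq_of_incr` — **for continuous paths, the laws on `C(ℝ≥0, ℂ)` agree**
  (`Literature.Probability.Process.measure_continuousMap_ext_of_fdd`).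

This is the packaging step of Lévy-type characterisations (Le Gall (2016), end of the proof of
Thm. 5.12 / Thm. 5.13: from the conditional characteristic function of the increments to "`β`
is a Brownian motion"), written for an arbitrary target law.

## References

* J.-F. Le Gall, *Brownian Motion, Martingales, and Stochastic Calculus* (2016), Thm. 5.12,
  Thm. 5.13 (proofs). [Legall2016]
* P. Billingsley, *Convergence of Probability Measures* (1999), Example 1.3. [Billingsley1999]
-/

noncomputable section

open MeasureTheory Filter Topology Set Complex
open scoped NNReal ENNReal BigOperators ComplexConjugate

namespace Literature.Probability.Process

/-! ### Uniqueness on `ℂⁿ` -/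

/-- `Re(w̄ z) = Re(z̄ w)`. [folklore] -/
theorem re_conj_mul_comm (w z : ℂ) : (conj w * z).re = (conj z * w).re := by
  simp [Complex.mul_re]; ring

/-- **Two finite measures on `ℂⁿ` with the same `∫ exp(i Σⱼ Re(θ̄ⱼ xⱼ))` for all `θ ∈ ℂⁿ` are
equal.** [cite: Billingsley1999, §26 (uniqueness for characteristic functions)] -/
theorem measure_ext_of_integral_cexp_re_conj {n : ℕ} {μ ν : Measure (Fin n → ℂ)} [IsFiniteMeasure μ]
    [IsFiniteMeasure ν]
    (h : ∀ θ : Fin n → ℂ, ∫ x, cexp (I * (∑ j, (conj (θ j) * x j).re : ℝ)) ∂μ =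
      ∫ x, cexp (I * (∑ j, (conj (θ j) * x j).re : ℝ)) ∂ν) : μ = ν := by
  haveI : IsFiniteMeasure (μ.map (MeasurableEquiv.toLp 2 (Fin n → ℂ))) := Measure.isFiniteMeasure_map _ _
  haveI : IsFiniteMeasure (ν.map (MeasurableEquiv.toLp 2 (Fin n → ℂ))) := Measure.isFiniteMeasure_map _ _
  refine (MeasurableEquiv.toLp 2 (Fin n → ℂ)).map_measurableEquiv_injective
    (Measure.ext_of_charFun (funext fun t ↦ ?_))
  have key : ∀ x : Fin n → ℂ, inner ℝ ((MeasurableEquiv.toLp 2 (Fin n → ℂ)) x) t =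
      ∑ j, (conj (t.ofLp j) * x j).re := fun x ↦ by
    rw [MeasurableEquiv.toLp_apply, PiLp.inner_apply]
    refine Finset.sum_congr rfl fun j _ ↦ ?_
    rw [PiLp.toLp_apply, Complex.inner, re_conj_mul_comm]
    simp [Complex.mul_re]; ring
  rw [charFun_apply, charFun_apply, integral_map_equiv, integral_map_equiv]
  simp_rw [key]
  have e := h (fun j ↦ t.ofLp j)
  simp_rw [mul_comm I] at e
  exact e

/-! ### Finite-dimensional distributions from increments -/

section Fdd

variable {Ω₁ Ω₂ : Type*} [MeasurableSpace Ω₁] [MeasurableSpace Ω₂] {P₁ : Measure Ω₁} {P₂ : Measure Ω₂}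
  [IsProbabilityMeasure P₁] [IsProbabilityMeasure P₂] {Z₁ : ℝ≥0 → Ω₁ → ℂ} {Z₂ : ℝ≥0 → Ω₂ → ℂ} {y₀ : ℂ}

/-- Extension of a finite family by zero. [folklore] -/
theorem measurable_extend_fin {n : ℕ} : Measurable fun (δ : Fin n → ℂ) (j : ℕ) ↦
    if h : j < n then δ ⟨j, h⟩ else (0 : ℂ) := by
  refine measurable_pi_lambda _ fun j ↦ ?_
  by_cases h : j < n
  · simp only [h, ↓reduceDIte]; exact measurable_pi_apply _
  · simp only [h, ↓reduceDIte]; exact measurable_const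

/-- **The finite-dimensional distributions of two processes with the same increment
characteristic functions (and the same deterministic starting point) agree.**
[cite: Legall2016, Thm. 5.13 (proof)] -/
theorem map_fdd_eq_of_incr (hm₁ : ∀ t, Measurable (Z₁ t)) (hm₂ : ∀ t, Measurable (Z₂ t))
    (h0₁ : ∀ ω, Z₁ 0 ω = y₀) (h0₂ : ∀ ω, Z₂ 0 ω = y₀)
    (hcf : ∀ u : ℕ → ℝ≥0, Monotone u → u 0 = 0 → ∀ (θ : ℕ → ℂ) (n : ℕ),
      ∫ ω, cexp (I * (∑ j ∈ Finset.range n, (conj (θ j) * (Z₁ (u (j + 1)) ω - Z₁ (u j) ω)).re : ℝ)) ∂P₁ =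
      ∫ ω, cexp (I * (∑ j ∈ Finset.range n, (conj (θ j) * (Z₂ (u (j + 1)) ω - Z₂ (u j) ω)).re : ℝ)) ∂P₂)
    (S : Finset ℝ≥0) :
    P₁.map (fun ω (i : S) ↦ Z₁ i ω) = P₂.map (fun ω (i : S) ↦ Z₂ i ω) := by
  set k := S.card with hk
  set e : Fin k ≃o S := S.orderIsoOfFin rfl with he
  -- the monotone grid `0, t₀, t₁, …, t_{k-1}, t_{k-1}, …`
  set t : ℕ → ℝ≥0 := fun j ↦ if h : j < k then ((e ⟨j, h⟩ : S) : ℝ≥0) else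
    if h' : 0 < k then ((e ⟨k - 1, Nat.sub_lt h' one_pos⟩ : S) : ℝ≥0) else 0 with ht
  have htmono : Monotone t := by
    intro a b hab
    simp only [ht]
    by_cases hb : b < k
    · have ha : a < k := lt_of_le_of_lt hab hb
      rw [dif_pos ha, dif_pos hb]
      exact_mod_cast e.monotone (Fin.mk_le_mk.2 hab)
    · rw [dif_neg hb]
      by_cases hk0 : 0 < k
      · rw [dif_pos hk0]
        by_cases ha : a < k
        · rw [dif_pos ha]
          exact_mod_cast e.monotone (Fin.mk_le_mk.2 (Nat.le_sub_one_of_lt ha))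
        · rw [dif_neg ha]
      · rw [dif_neg hk0]
        have ha : ¬ a < k := fun h ↦ hk0 (lt_of_le_of_lt (Nat.zero_le a) h)
        rw [dif_neg ha]
  set u : ℕ → ℝ≥0 := fun j ↦ if j = 0 then 0 else t (j - 1) with hu
  have humono : Monotone u := by
    intro a b hab
    simp only [hu]
    by_cases ha : a = 0
    · simp [ha]
    · have hb : b ≠ 0 := by omega
      rw [if_neg ha, if_neg hb]
      exact htmono (by omega)
  have hu0 : u 0 = 0 := by simp [hu]
  have husucc : ∀ j, u (j + 1) = t j := fun j ↦ by simp [hu]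
  -- the reconstruction map `Θ δ i = y₀ + Σ_{j ≤ e⁻¹ i} δ_j`
  set Θ : (Fin k → ℂ) → (S → ℂ) := fun δ i ↦ y₀ + ∑ j ∈ Finset.range ((e.symm i : ℕ) + 1),
    (if h : j < k then δ ⟨j, h⟩ else 0) with hΘ
  have hΘm : Measurable Θ := by
    refine measurable_pi_lambda _ fun i ↦ measurable_const.add ?_
    refine Finset.measurable_sum _ fun j _ ↦ ?_
    exact (measurable_pi_apply j).comp measurable_extend_fin
  -- increments over the grid
  set V₁ : Ω₁ → (Fin k → ℂ) := fun ω j ↦ Z₁ (u (j + 1)) ω - Z₁ (u j) ω with hV₁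
  set V₂ : Ω₂ → (Fin k → ℂ) := fun ω j ↦ Z₂ (u (j + 1)) ω - Z₂ (u j) ω with hV₂
  have hV₁m : Measurable V₁ := measurable_pi_lambda _ fun j ↦ (hm₁ _).sub (hm₁ _)
  have hV₂m : Measurable V₂ := measurable_pi_lambda _ fun j ↦ (hm₂ _).sub (hm₂ _)
  -- reconstruction: `Θ ∘ V = fdd`
  have hlt : ∀ (i : S), ∀ j ∈ Finset.range ((e.symm i : ℕ) + 1), j < k := fun i j hj ↦ by
    rw [Finset.mem_range] at hj
    exact lt_of_lt_of_le hj (e.symm i).2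
  have hrec₁ : ∀ ω, Θ (V₁ ω) = fun i : S ↦ Z₁ i ω := by
    intro ω
    funext i
    simp only [hΘ, hV₁]
    rw [Finset.sum_congr rfl (g := fun j ↦ Z₁ (u (j + 1)) ω - Z₁ (u j) ω) (fun j hj ↦ by rw [dif_pos (hlt i j hj)]),
      Finset.sum_range_sub (fun j ↦ Z₁ (u j) ω), hu0, h0₁, husucc]
    simp only [ht, dif_pos (e.symm i).2, Fin.eta, OrderIso.apply_symm_apply]
    ring
  have hrec₂ : ∀ ω, Θ (V₂ ω) = fun i : S ↦ Z₂ i ω := by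
    intro ω
    funext i
    simp only [hΘ, hV₂]
    rw [Finset.sum_congr rfl (g := fun j ↦ Z₂ (u (j + 1)) ω - Z₂ (u j) ω) (fun j hj ↦ by rw [dif_pos (hlt i j hj)]),
      Finset.sum_range_sub (fun j ↦ Z₂ (u j) ω), hu0, h0₂, husucc]
    simp only [ht, dif_pos (e.symm i).2, Fin.eta, OrderIso.apply_symm_apply]
    ring
  have hf₁ : (fun ω (i : S) ↦ Z₁ i ω) = Θ ∘ V₁ := by
    funext ω; exact (hrec₁ ω).symm
  have hf₂ : (fun ω (i : S) ↦ Z₂ i ω) = Θ ∘ V₂ := by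
    funext ω; exact (hrec₂ ω).symm
  -- the laws of the increment vectors agree
  have hV : P₁.map V₁ = P₂.map V₂ := by
    haveI : IsFiniteMeasure (P₁.map V₁) := Measure.isFiniteMeasure_map _ _
    haveI : IsFiniteMeasure (P₂.map V₂) := Measure.isFiniteMeasure_map _ _
    refine measure_ext_of_integral_cexp_re_conj fun θ ↦ ?_
    have hgm : ∀ θ : Fin k → ℂ, Measurable fun x : Fin k → ℂ ↦ cexp (I * (∑ j, (conj (θ j) * x j).re : ℝ)) :=
      fun θ ↦ Complex.measurable_exp.comp (measurable_const.mul (Complex.measurable_ofReal.comp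
        (Finset.measurable_sum _ fun j _ ↦ Complex.measurable_re.comp ((measurable_pi_apply j).const_mul _))))
    rw [integral_map hV₁m.aemeasurable (hgm θ).aestronglyMeasurable,
      integral_map hV₂m.aemeasurable (hgm θ).aestronglyMeasurable]
    set θ' : ℕ → ℂ := fun j ↦ if h : j < k then θ ⟨j, h⟩ else 0 with hθ'
    have hsum : ∀ (D : ℕ → ℂ),
        (∑ j : Fin k, (conj (θ j) * D j).re) = ∑ j ∈ Finset.range k, (conj (θ' j) * D j).re := by
      intro D
      rw [← Fin.sum_univ_eq_sum_range (fun j ↦ (conj (θ' j) * D j).re) k]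
      refine Finset.sum_congr rfl fun j _ ↦ ?_
      simp only [hθ', dif_pos j.2, Fin.eta]
    have e₁ : ∀ ω, (∑ j : Fin k, (conj (θ j) * V₁ ω j).re) =
        ∑ j ∈ Finset.range k, (conj (θ' j) * (Z₁ (u (j + 1)) ω - Z₁ (u j) ω)).re := fun ω ↦
      hsum (fun j ↦ Z₁ (u (j + 1)) ω - Z₁ (u j) ω)
    have e₂ : ∀ ω, (∑ j : Fin k, (conj (θ j) * V₂ ω j).re) =
        ∑ j ∈ Finset.range k, (conj (θ' j) * (Z₂ (u (j + 1)) ω - Z₂ (u j) ω)).re := fun ω ↦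
      hsum (fun j ↦ Z₂ (u (j + 1)) ω - Z₂ (u j) ω)
    simp_rw [e₁, e₂]
    exact hcf u humono hu0 θ' k
  rw [hf₁, hf₂, ← Measure.map_map hΘm hV₁m, ← Measure.map_map hΘm hV₂m, hV]

/-- **Continuous complex processes with the same increment characteristic functions and the same
deterministic starting point have the same law on `C(ℝ≥0, ℂ)`.** [cite: Legall2016, Thm. 5.13 (proof)] -/
theorem map_path_eq_of_incr [MeasurableSpace C(ℝ≥0, ℂ)] [BorelSpace C(ℝ≥0, ℂ)]
    (hm₁ : ∀ t, Measurable (Z₁ t)) (hm₂ : ∀ t, Measurable (Z₂ t))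
    (hc₁ : ∀ ω, Continuous (Z₁ · ω)) (hc₂ : ∀ ω, Continuous (Z₂ · ω))
    (h0₁ : ∀ ω, Z₁ 0 ω = y₀) (h0₂ : ∀ ω, Z₂ 0 ω = y₀)
    (hcf : ∀ u : ℕ → ℝ≥0, Monotone u → u 0 = 0 → ∀ (θ : ℕ → ℂ) (n : ℕ),
      ∫ ω, cexp (I * (∑ j ∈ Finset.range n, (conj (θ j) * (Z₁ (u (j + 1)) ω - Z₁ (u j) ω)).re : ℝ)) ∂P₁ =
      ∫ ω, cexp (I * (∑ j ∈ Finset.range n, (conj (θ j) * (Z₂ (u (j + 1)) ω - Z₂ (u j) ω)).re : ℝ)) ∂P₂) :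
    P₁.map (fun ω ↦ (⟨fun t ↦ Z₁ t ω, hc₁ ω⟩ : C(ℝ≥0, ℂ))) =
      P₂.map (fun ω ↦ (⟨fun t ↦ Z₂ t ω, hc₂ ω⟩ : C(ℝ≥0, ℂ))) := by
  have hpm₁ : Measurable fun ω ↦ (⟨fun t ↦ Z₁ t ω, hc₁ ω⟩ : C(ℝ≥0, ℂ)) := by
    have := measurable_continuousMap_of_eval (Φ := fun ω ↦ (⟨fun t ↦ Z₁ t ω, hc₁ ω⟩ : C(ℝ≥0, ℂ)))
      fun a ↦ hm₁ a
    rwa [← BorelSpace.measurable_eq] at this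
  have hpm₂ : Measurable fun ω ↦ (⟨fun t ↦ Z₂ t ω, hc₂ ω⟩ : C(ℝ≥0, ℂ)) := by
    have := measurable_continuousMap_of_eval (Φ := fun ω ↦ (⟨fun t ↦ Z₂ t ω, hc₂ ω⟩ : C(ℝ≥0, ℂ)))
      fun a ↦ hm₂ a
    rwa [← BorelSpace.measurable_eq] at this
  haveI : IsFiniteMeasure (P₁.map fun ω ↦ (⟨fun t ↦ Z₁ t ω, hc₁ ω⟩ : C(ℝ≥0, ℂ))) :=
    Measure.isFiniteMeasure_map _ _
  refine measure_continuousMap_ext_of_fdd fun S ↦ ?_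
  have hres : Measurable fun (γ : C(ℝ≥0, ℂ)) (i : S) ↦ γ i :=
    measurable_pi_lambda _ fun i ↦ (continuous_eval_const (i : ℝ≥0)).measurable
  rw [Measure.map_map hres hpm₁, Measure.map_map hres hpm₂]
  exact map_fdd_eq_of_incr hm₁ hm₂ h0₁ h0₂ hcf S

end Fdd

end Literature.Probability.Process

end
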